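import Summits.CriticalPhenomena.PercolationContinuityZ3.Theorems.PercNearOneGluingNoHeavyLowerTailNineTypeLabelCert

/-!
# Two-copy bridge, GRAPH-FIBRE form: packing laws from counts on graph fibres only

Support file for crux `stmt-CriticalPhenomena-4575` (master-family programme, quadratic four-point rows `Q44`/single-source),
seat `prim-bnk-1` gen 27; memo `run/shared/lean/prim/prim-l12/FROM-prim-bnk-1-gen27-SINGLE-SOURCE-ANATOMY.md` §9(3).

`TwoCopyMono.sum_kernel_cell_nonneg` (`…TwoCopyMonotoneBridge`) derives `0 ≤ Σ κᵢⱼ cellᵢ cellⱼ` on every finite weighted graph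
from `GoodKernel κ`, a statement about ALL monotone equivalence-valued profile maps on the subsets of a finite type
("lattice-general").  Its proof only ever uses the maps `T ↦ prof a b c y (C ∪ T)` on the subsets `T ⊆ M` of a fibre
`(M, C)` of the two-copy expansion — connection profiles of an actual graph.  Gen 27 shows that this distinction matters: the
transversal GF(2) certificates for the single-source packing exist in every graph fibre tested but are FALSE for general
monotone maps (memo §5).  This file records the bridge with the weaker, graph-fibre hypothesis:

* `sum_kernel_cell_nonneg_of_fibres` — if `0 ≤ Σ_{T ⊆ M} liftK κ (prof (C ∪ T)) (prof (C ∪ (M ∖ T)))` for all disjoint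
  `M, C ⊆ Sym2 (Fin n)`, then `0 ≤ Σ κᵢⱼ cellᵢ cellⱼ` for every weight `w` on `Fin n`;
* `fibre_nonneg_of_goodKernel` — the lattice-general hypothesis implies the graph-fibre one;
* `pack_of_graphFibreCount` — LAW LEVEL for packing kernels `kerP P`: if in every graph fibre, for a cell labelling `ι` of the
  fibre (`prof (C ∪ T) = pp (ι T)`), `#{T ⊆ M : (ι T, ι (M ∖ T)) ∈ P} ≤ #{T ⊆ M : ι T ∈ AC, ι (M ∖ T) = ⊥}`, then
  `Σ_{(h,l) ∈ P} cell h · cell l ≤ (cell(ab|cy) + cell(abcy)) · cell(a|b|c|y)` for that `n` and those marked points;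
* `ple_fibreMap`, `exists_fibreMap` — such labellings exist and are monotone in the cell order (the form in which fibre
  files state their hypotheses).

No named facts, no sorries, no new definitions; standard axioms.
-/

noncomputable section

namespace Summit.CriticalPhenomena.PercolationContinuityZ3.Theorems

open MeasureTheory Set Finset Literature.Probability.Percolation
open Literature.Probability.LatticeModels (prodBernoulli)

namespace TwoCopyMono

variable {n : ℕ}

/-- **The bridge from graph fibres.**  If the antipodal count of `κ` is nonnegative on every fibre `(M, C)` of the graph
`Fin n` — i.e. for the profile maps `T ↦ prof a b c y (C ∪ T)`, `T ⊆ M` — then the bilinear cell form of `κ` is nonnegative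
for every edge weight on `Fin n`. [this work] -/
theorem sum_kernel_cell_nonneg_of_fibres {κ : Fin 15 → Fin 15 → ℤ} (a b c y : Fin n)
    (hκ : ∀ (M C : Finset (Sym2 (Fin n))), Disjoint C M →
      0 ≤ ∑ T ∈ M.powerset, liftK κ (prof a b c y ↑(C ∪ T)) (prof a b c y ↑(C ∪ (M \ T))))
    (w : Sym2 (Fin n) → unitInterval) :
    0 ≤ ∑ i : Fin 15, ∑ j : Fin 15, (κ i j : ℝ) * FourPointAtoms.cell w a b c y i * FourPointAtoms.cell w a b c y j := by
  classical
  rw [sum_kernel_cell_eq_pairs, sum_pairs_eq_sum_fibres]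
  refine Finset.sum_nonneg fun M _ => Finset.sum_nonneg fun C hC => ?_
  rw [Finset.mem_powerset] at hC
  have hCM : Disjoint C M := by
    rw [Finset.disjoint_left]; intro e heC heM; exact (Finset.mem_compl.1 (hC heC)) heM
  have hrw : ∀ T ∈ M.powerset,
      (liftK κ (prof a b c y ↑(C ∪ T)) (prof a b c y ↑(C ∪ (M \ T))) : ℝ) * (wt w (C ∪ T) * wt w (C ∪ (M \ T))) =
        wt2 w M C * (liftK κ (prof a b c y ↑(C ∪ T)) (prof a b c y ↑(C ∪ (M \ T))) : ℝ) := by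
    intro T hT
    rw [Finset.mem_powerset] at hT
    rw [wt_pair_eq w hT]; ring
  rw [Finset.sum_congr rfl hrw, ← Finset.mul_sum]
  refine mul_nonneg (wt2_nonneg w M C) ?_
  have h := hκ M C hCM
  exact_mod_cast h

/-- The lattice-general hypothesis `GoodKernel κ` implies the graph-fibre hypothesis (reindexing `M.powerset ≃ Finset ↥M`,
as in `sum_kernel_cell_nonneg`). [this work] -/
theorem fibre_nonneg_of_goodKernel {κ : Fin 15 → Fin 15 → ℤ} (hκ : GoodKernel κ) (a b c y : Fin n)
    (M C : Finset (Sym2 (Fin n))) :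
    0 ≤ ∑ T ∈ M.powerset, liftK κ (prof a b c y ↑(C ∪ T)) (prof a b c y ↑(C ∪ (M \ T))) := by
  classical
  let emb : Finset ↥M → Finset (Sym2 (Fin n)) := fun T => T.map (Function.Embedding.subtype _)
  let P : Finset ↥M → Prof := fun T => prof a b c y ↑(C ∪ emb T)
  have hmono : ∀ S T : Finset ↥M, S ⊆ T → ProfLE (P S) (P T) := by
    intro S T hST
    apply prof_mono
    intro e he
    simp only [Finset.coe_union, Set.mem_union, Finset.mem_coe] at he ⊢
    rcases he with he | he
    · exact Or.inl he
    · right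
      simp only [emb, Finset.mem_map, Function.Embedding.coe_subtype] at he ⊢
      obtain ⟨x, hx, rfl⟩ := he
      exact ⟨x, hST hx, rfl⟩
  have heqv : ∀ S : Finset ↥M, IsEqv (P S) := fun S => prof_isEqv a b c y _
  have hgood := hκ.nonneg (↥M) P hmono heqv
  have hre : (∑ T : Finset ↥M, liftK κ (P T) (P Tᶜ)) =
      ∑ T ∈ M.powerset, liftK κ (prof a b c y ↑(C ∪ T)) (prof a b c y ↑(C ∪ (M \ T))) := by
    refine Finset.sum_bij' (fun T _ => emb T) (fun T _ => T.subtype (· ∈ M)) ?_ ?_ ?_ ?_ ?_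
    · intro T _
      rw [Finset.mem_powerset]
      intro e he
      simp only [emb, Finset.mem_map, Function.Embedding.coe_subtype] at he
      obtain ⟨x, _, rfl⟩ := he
      exact x.2
    · intro T _; exact Finset.mem_univ _
    · intro T _
      ext x
      simp [emb]
    · intro T hT
      rw [Finset.mem_powerset] at hT
      simp only [emb, Finset.subtype_map]
      exact Finset.filter_true_of_mem fun e he => hT he
    · intro T _
      have h1 : emb Tᶜ = M \ emb T := by
        ext e
        simp only [emb, Finset.mem_map, Function.Embedding.coe_subtype, Finset.mem_sdiff, Finset.mem_compl]
        constructor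
        · rintro ⟨x, hx, rfl⟩
          exact ⟨x.2, fun ⟨x', hx', he⟩ => hx (by rwa [Subtype.ext he] at hx')⟩
        · rintro ⟨heM, hne⟩
          exact ⟨⟨e, heM⟩, fun h => hne ⟨⟨e, heM⟩, h, rfl⟩, rfl⟩
      show liftK κ (P T) (P Tᶜ) = _
      simp only [P]
      rw [h1]
  rw [← hre]
  exact hgood

/-- A cell labelling of a graph fibre is monotone in the refinement order of the 15 cells. [this work] -/
theorem ple_fibreMap (a b c y : Fin n) (C : Finset (Sym2 (Fin n))) (ι : Finset (Sym2 (Fin n)) → Fin 15)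
    (hι : ∀ T : Finset (Sym2 (Fin n)), prof a b c y ↑(C ∪ T) = pp (ι T)) {A B : Finset (Sym2 (Fin n))} (hAB : A ⊆ B) :
    ple (ι A) (ι B) = true := by
  apply ple_of_profLE
  rw [← hι A, ← hι B]
  apply prof_mono
  intro e he
  simp only [Finset.coe_union, Set.mem_union, Finset.mem_coe] at he ⊢
  rcases he with he | he
  · exact Or.inl he
  · exact Or.inr (hAB he)

/-- Every graph fibre has a cell labelling (profiles of configurations are equivalences, hence one of the 15 patterns).
[this work] -/
theorem exists_fibreMap (a b c y : Fin n) (C : Finset (Sym2 (Fin n))) :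
    ∃ ι : Finset (Sym2 (Fin n)) → Fin 15, ∀ T : Finset (Sym2 (Fin n)), prof a b c y ↑(C ∪ T) = pp (ι T) := by
  have hex : ∀ T : Finset (Sym2 (Fin n)), ∃ i : Fin 15, prof a b c y ↑(C ∪ T) = pp i :=
    fun T => exists_pat_of_isEqv (prof_isEqv a b c y _)
  choose ι hι using hex
  exact ⟨ι, hι⟩

/-- **Packing laws from graph-fibre counts.**  Let `P` be a set of (heavy, light) cell pairs.  If for the marked points
`a b c y` of `Fin n`, in every fibre `(M, C)` and for every cell labelling `ι` of it, the number of `T ⊆ M` with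
`(ι T, ι (M ∖ T)) ∈ P` is at most the number of `T ⊆ M` with `ι T ∈ AC` and `ι (M ∖ T) = ⊥`, then for every edge weight on
`Fin n`:  `Σ_{(h,l) ∈ P} cell h · cell l ≤ (cell(ab|cy) + cell(abcy)) · cell(a|b|c|y)`. [this work] -/
theorem pack_of_graphFibreCount (P : Finset (Fin 15 × Fin 15)) (a b c y : Fin n)
    (hP : ∀ (M C : Finset (Sym2 (Fin n))), Disjoint C M → ∀ ι : Finset (Sym2 (Fin n)) → Fin 15,
      (∀ T : Finset (Sym2 (Fin n)), prof a b c y ↑(C ∪ T) = pp (ι T)) →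
        #(M.powerset.filter fun T => (ι T, ι (M \ T)) ∈ P) ≤
          #(M.powerset.filter fun T => isAC (ι T) ∧ ι (M \ T) = 0))
    (w : Sym2 (Fin n) → unitInterval) :
    ∑ p ∈ P, FourPointAtoms.cell w a b c y p.1 * FourPointAtoms.cell w a b c y p.2 ≤
      (FourPointAtoms.cell w a b c y 11 + FourPointAtoms.cell w a b c y 14) * FourPointAtoms.cell w a b c y 0 := by
  classical
  have hfib : ∀ (M C : Finset (Sym2 (Fin n))), Disjoint C M →
      0 ≤ ∑ T ∈ M.powerset, liftK (kerP P) (prof a b c y ↑(C ∪ T)) (prof a b c y ↑(C ∪ (M \ T))) := by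
    intro M C hCM
    obtain ⟨ι, hι⟩ := exists_fibreMap a b c y C
    have h1 : ∀ T ∈ M.powerset, liftK (kerP P) (prof a b c y ↑(C ∪ T)) (prof a b c y ↑(C ∪ (M \ T))) =
        (if isAC (ι T) ∧ ι (M \ T) = 0 then (1 : ℤ) else 0) - (if (ι T, ι (M \ T)) ∈ P then (1 : ℤ) else 0) := by
      intro T _
      rw [hι T, hι (M \ T), liftK_pp]
      rfl
    rw [Finset.sum_congr rfl h1, Finset.sum_sub_distrib, Finset.sum_boole, Finset.sum_boole]
    have h2 := hP M C hCM ι hι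
    have h3 : ((#(M.powerset.filter fun T => (ι T, ι (M \ T)) ∈ P) : ℕ) : ℤ) ≤
        ((#(M.powerset.filter fun T => isAC (ι T) ∧ ι (M \ T) = 0) : ℕ) : ℤ) := by exact_mod_cast h2
    linarith
  have h := sum_kernel_cell_nonneg_of_fibres a b c y hfib w
  rw [sum_kerP_cell P] at h
  linarith

end TwoCopyMono

end Summit.CriticalPhenomena.PercolationContinuityZ3.Theorems

end
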